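import Mathlib
import HarnessLib
import Summits.HubbardSuperconductivity.HubbardSuperconductivity.Theses.KLProgramme
import Summits.HubbardSuperconductivity.HubbardSuperconductivity.Theorems.KLProgrammeKLRegimeSplitGlueV12P4Ex

/-!
# Gen-4 glue closer for `KLRegimeTwoPointLimitGlueV12` (route KLProgramme, rev 15/16)

One-line closer of the gen-4 glue item `stmt-HubbardSuperconductivity-19860`
(`KLRegimeTwoPointLimitGlueV12 := KLRegimeEngineV12 → KLRegimeBetaSplitV12 → KLRegimeCountertermV12 →
KLRegimeVolumeLimitV12 → KLRegimeTwoPointAssemblyV12 → KLRegimeTwoPointLimit`) by the downstream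
induction theorem `KLRegimeSplit.KLRegimeInductionV12P4Ex` (Theorems/KLProgrammeKLRegimeSplitGlueV12P4Ex.lean, k3c5-p2 G6b p476024; Δ-VL1 slot `FinalTwoLegVolLimitEx`).
File with `ledger propose --kind proof --target Summits/HubbardSuperconductivity/HubbardSuperconductivity/Theorems/KLProgrammeKLRegimeTwoPointLimitGlueV12P4Closes.lean --file <this> --workitem stmt-HubbardSuperconductivity-19860`.
-/

namespace Summit.HubbardSuperconductivity.HubbardSuperconductivity.Theorems.KLRegimeSplit

/-- The gen-4 glue item holds: the five V12 children imply `KLRegimeTwoPointLimit`. -/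
theorem klRegimeTwoPointLimitGlueV12_holds :
    Summit.HubbardSuperconductivity.HubbardSuperconductivity.Theses.KLProgramme.KLRegimeTwoPointLimitGlueV12 :=
  fun h₁ h₂ h₃ h₄ h₅ => KLRegimeInductionV12P4Ex h₁ h₂ h₃ h₄ h₅

end Summit.HubbardSuperconductivity.HubbardSuperconductivity.Theorems.KLRegimeSplit
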